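import Summits.BirchSwinnertonDyer.BirchSwinnertonDyer.Theorems.KolyvaginRankRigidityAtTwoTransverseClassAtTwoReduction
import Summits.BirchSwinnertonDyer.BirchSwinnertonDyer.Theorems.ClassRecordThreeEulerHalvesAtThreeWalkSupplyTransverse
import HarnessLib

/-!
# Crux V2♭θ / V2♭∞ (stmt-BirchSwinnertonDyer-27220; line `kolyvagin_depth_split`), stub S1, piece P4 —
# Kolyvagin's class is TRANSVERSE at the primes of its conductor at `p = 2` (margin one), UNCONDITIONALLY (II)

Sequel of `…TransverseClassAtTwoReduction` (algebra + BRICK B3 at any prime `p` with `p^k ∣ ℓ(ℓ+1)/2`):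
* `kolyvaginClass_mem_transverseKer_of_dvd` — Howard 2004 Lemma 2.7.3 at ANY prime under `p^k ∣ ℓ(ℓ+1)/2`
  (byte-for-byte the odd-`p` `JET.kolyvaginClass_mem_transverseKer`, cell bsd-jet seat pv-2, whose only use
  of `p ≠ 2` was that divisibility);
* `kolyvaginClass_mem_transverseKer_two` — `p = 2`, margin one `k + 1 ≤ M(ℓ)` (`2^{k+1} ∣ ℓ + 1`);
* `localization_kolyvaginClass_mem_globalTransverse_two` — the binder `hP4` of the S1 composition
  `primeSwapAtTwoLossy_core[_frob]` for the GLOBAL intrinsic transverse family (`Walk.exists_globalTransverseFamily`,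
  reconciliation `Walk.globalTransverse_mem_iff`).
So P4 at `2` is a THEOREM (no Gross 3.7 (2) input). HONEST FRAMING: helper (`--supports` 27220); S1 / V2♭θ /
BSD are NOT proved here.
References: [cite: Howard2004HeegnerKolyvagin, Lemma 2.7.3] [cite: Jetchev2008, §3.1.2 (p. 814), §3.4.1
(p. 816), Prop. 4.6 (p. 820)] [cite: GrossLMS1991, §4 (4.4), (4.6)] [cite: McCallumLMS1991, Lemma 4.3]
[cite: NeukirchANT1999, Ch. II §9 Prop. (9.6)].
-/

set_option autoImplicit false

noncomputable section

open scoped Classical Pointwise Valued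

open WeierstrassCurve Field NumberField IsDedekindDomain Module ValuativeRel
  Literature.NumberTheory.EllipticCurves Literature.NumberTheory.EllipticCurves.RingClassField
  Literature.NumberTheory.EllipticCurves.ModularForms Literature.NumberTheory.EllipticCurves.Jetchev2008
  Literature.NumberTheory.EllipticCurves.KolyvaginCocycle
  Literature.NumberTheory.GaloisRepresentations Literature.NumberTheory.GaloisRepresentations.DiscreteGaloisModule
  Literature.NumberTheory.GaloisRepresentations.IsNonarchimedeanLocalField
  Literature.NumberTheory.NumberFields Literature.NumberTheory.Automorphic Literature
  Summit.BirchSwinnertonDyer.Rank1Residual.X11b Summit.BirchSwinnertonDyer.Rank1Residual.JET.SelmerVocabulary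

namespace Summit.BirchSwinnertonDyer.Rank1Residual.JET

/-! ## §3 Howard's Lemma 2.7.3 at any prime, and at `p = 2` with margin one -/

section Main

variable {K : Type} [Field K] [NumberField K]
variable (W : WeierstrassCurve ℚ) [W.IsElliptic] [W.IsGloballyMinimal] [NeZero (W.conductorNorm ℤ)]

/-- **Kolyvagin's class is transverse at the primes of its level, ANY prime `p` with `p^k ∣ ℓ(ℓ+1)/2`**
(twin of `kolyvaginClass_mem_transverseKer`, whose only use of `p ≠ 2` is that divisibility; Howard 2004, Lemma 2.7.3;
Jetchev 2008, p. 820: the classes `c_k(c)` «are known to satisfy the local conditions for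
`𝓕(c)`»). For `W/ℚ` globally minimal, `K` imaginary quadratic with `d_K < -4`, `p` odd, `c`
square-free all of whose prime factors are Zhang–Kolyvagin primes with `k ≤ M(ℓ)`, the tree's
concrete Kolyvagin data `d` at level `c` and a prime `ℓ ∣ c`: `d.kolyvaginClass p k ∈
transverseKer W K ι p^k ℓ`, i.e. `loc_{w'} res_{K[ℓ]/K} c_k(c) = 0` at every place `w' ∋ ℓ` of
`K[ℓ]`. This is the binder `htr` of the road-K END FORMS (`JET.jetchevDivisibilityCarrierMult_of_localFacts`
and twins) under the END FORMS' standing hypothesis `d_K ∉ {-3, -4}`.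
[cite: Howard2004HeegnerKolyvagin, Lemma 2.7.3] [cite: Jetchev2008, Prop. 4.6 (p. 820)]
[cite: GrossLMS1991, §4 (4.4), (4.6)] -/
theorem kolyvaginClass_mem_transverseKer_of_dvd (hK : IsImaginaryQuadratic K)
    (hD : NumberField.discr K < -4) {p : ℕ} [Fact p.Prime]
    (Dt : ModularParametrizationData W (W.conductorNorm ℤ)) (β : ℤ) (ι : K →+* ℂ)
    [∀ j : ℕ, NumberField (ringClassField K ι j)] (k : ℕ) {c : ℕ} (hc : Squarefree c)
    (hcK : ∀ ℓ ∈ c.primeFactors, Zhang2014.IsKolyvaginPrime (W.conductorNorm ℤ) W K p ℓ ∧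
      k ≤ Zhang2014.kolyvaginIndex W p ℓ)
    (d : KolyvaginHeegnerData Dt β ι c) {ℓ : ℕ} (hℓ : ℓ ∈ c.primeFactors)
    (hchoose : p ^ k ∣ ℓ * (ℓ + 1) / 2) :
    (d.kolyvaginClass (Fact.out : p.Prime) k :
      galoisCohomology ((W.baseChange K).torsionGaloisModule ((p ^ k : ℕ) : ℤ)) 1) ∈
      transverseKer W K ι ((p ^ k : ℕ) : ℤ) ℓ := by
  have hp : p.Prime := Fact.out
  have hc0 : c ≠ 0 := hc.ne_zero
  obtain ⟨hℓK, hkM⟩ := hcK ℓ hℓ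
  obtain ⟨hℓp, hℓN, -, hℓnep, hinertℓ, -⟩ := hℓK
  haveI : Fact ℓ.Prime := ⟨hℓp⟩
  have hℓc : ℓ ∣ c := Nat.dvd_of_mem_primeFactors hℓ
  have hinert : ∀ q ∈ c.primeFactors, (Ideal.span {(q : 𝓞 K)}).IsPrime := fun q hq ↦
    (hcK q hq).1.2.2.2.2.1
  -- `ℓ ∤ Δ_min` and `ℓ ∤ p^k`
  have hgood : W.HasGoodReductionAtPrime ℓ := by
    by_contra h
    exact hℓN ((dvd_conductorNorm_iff_not_hasGoodReductionAtPrime W ℓ).mpr h)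
  have hΔ : ¬ (ℓ : ℤ) ∣ minimalDiscriminantInt W :=
    not_dvd_minimalDiscriminantInt_of_hasGoodReductionAtPrime' W ℓ hgood
  have hℓpk : ¬ ℓ ∣ p ^ k := fun h ↦ hℓnep ((Nat.prime_dvd_prime_iff_eq hℓp hp).mp (hℓp.dvd_of_dvd_pow h))
  have hpk0 : p ^ k ≠ 0 := pow_ne_zero k hp.ne_zero
  set n : ℤ := ((p ^ k : ℕ) : ℤ) with hn
  set ρK := (W.baseChange K).torsionGaloisModule n with hρK
  -- the junk case
  by_cases hadm : KolyvaginCocycle.IsAdmissible (absoluteGaloisGroup K) d.pointsSubgroup n ∧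
      d.toGeomPoints d.derivedPoint ∈
        KolyvaginCocycle.invPoints (absoluteGaloisGroup K) d.pointsSubgroup n
  swap
  · rw [KolyvaginHeegnerData.kolyvaginClass, dif_neg hadm]
    exact zero_mem _
  obtain ⟨hA, hPinv⟩ := hadm
  set P : geomPoints (W.baseChange K) := d.toGeomPoints d.derivedPoint with hPdef
  have hdiv := (W.baseChange K).zsmul_geomPoints_surjective_of_charZero
    (n := n) (by rw [hn]; exact_mod_cast hpk0)
  obtain ⟨Q, hQ⟩ := hdiv P
  have hQ : n • Q = P := hQ
  rw [d.kolyvaginClass_of_admissible hp k hA hPinv, kolyvaginClass_eq_cls hA hPinv hQ]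
  -- the place `λ = (ℓ)`, the prime `𝔓₀` of the completion, the reduction
  have hne : Ideal.span {((ℓ : ℕ) : 𝓞 K)} ≠ ⊥ := by
    rw [Ne, Ideal.span_singleton_eq_bot]; exact_mod_cast hℓp.ne_zero
  let v : HeightOneSpectrum (𝓞 K) := ⟨Ideal.span {((ℓ : ℕ) : 𝓞 K)}, hinertℓ, hne⟩
  have hv : v.asIdeal = Ideal.span {((ℓ : ℕ) : 𝓞 K)} := rfl
  have hℓv : ((ℓ : ℕ) : 𝓞 K) ∈ v.asIdeal := Ideal.mem_span_singleton_self _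
  have huniq : ∀ w : HeightOneSpectrum (𝓞 K), (ℓ : 𝓞 K) ∈ w.asIdeal → w = v :=
    fun w hw ↦ eq_of_natCast_mem_of_asIdeal_eq_span hv w hw
  set 𝔓₀ := adicCompletionPrime K v with h𝔓₀def
  have h𝔓₀ : 𝔓₀ ∈ v.primesAbove := adicCompletionPrime_mem_primesAbove K v
  have hDrange := decompositionSubgroup_adicCompletionPrime_eq_range K v
  have hDfix : 𝔓₀.decompositionSubgroup (absoluteGaloisGroup K) ≤
      torsionFixing (W.baseChange K) n :=
    GlobalDuality.decompositionSubgroup_le_torsionFixing W K hK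
      ⟨hℓp, hℓN, (hcK ℓ hℓ).1.2.2.1, hℓnep, hinertℓ, (hcK ℓ hℓ).1.2.2.2.2.2⟩ hkM v hℓv h𝔓₀
  have hresD : ∀ σ : absoluteGaloisGroup (v.adicCompletion K),
      absGaloisRestrict K (v.adicCompletion K) σ ∈ 𝔓₀.decompositionSubgroup (absoluteGaloisGroup K) := fun σ ↦ by
    rw [hDrange]; exact ⟨σ, rfl⟩
  -- the `ℓ`-power Frobenius of `𝔽̄_ℓ` and BRICK B2
  obtain ⟨φ₀, hφ₀'⟩ := WeierstrassCurve.exists_frobenius_absoluteGaloisGroup (ZMod ℓ)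
  have hφ₀ : ∀ x : AlgebraicClosure (ZMod ℓ), φ₀ • x = x ^ ℓ := fun x ↦ by
    rw [hφ₀' x, Nat.card_zmod]
  obtain ⟨red, hsurj, hredI, hredF, hredinj⟩ :=
    exists_kolyvaginReduction W hΔ hφ₀ hℓv huniq h𝔓₀
  -- BRICK B3: `red P = p^k • b`, `φ₀² b = b`
  obtain ⟨b, hb, hφb⟩ := exists_red_derivedPoint_eq_pow_smul_of_dvd hK ι hc hℓp hℓc hinert hchoose
    hv h𝔓₀ d φ₀ red hredI (fun g hg ↦ hredF g 2 hg)
  -- a Frobenius at `𝔓₀` fixing `K[c]` (hence `E[p^k]`), so `φ₀²` fixes `Ẽ[p^k]`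
  let e : ringClassField K ι c →ₐ[K] AlgebraicClosure K := { d.emb with commutes' := d.emb_apply }
  have he : ∀ x, e x = d.emb x := fun _ ↦ rfl
  obtain ⟨Fr, hFrz, -⟩ := exists_frobSq_forall_smul_emb_eq hK ι hc hℓp hℓc hinertℓ hv h𝔓₀ e
  have hFrD : Fr ∈ 𝔓₀.decompositionSubgroup (absoluteGaloisGroup K) := by
    haveI := h𝔓₀.1
    have hFr : IsArithFrobAt (𝓞 K) Fr 𝔓₀ := by
      rw [HeightOneSpectrum.isArithFrobAt_iff_of_mem_primesAbove h𝔓₀,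
        residueCard_eq_sq_of_asIdeal_eq_span hK hℓp hinertℓ hv]
      exact hFrz
    exact hFr.mem_stabilizer
  have hφtors : ∀ b' : (reductionModPrime W ℓ).geomPoints, ((p ^ k : ℕ) : ℤ) • b' = 0 →
      (φ₀ ^ 2) • b' = b' := by
    intro b' hb'
    obtain ⟨Q', hQ'0, rfl⟩ := exists_torsion_lift_baseChange W hΔ hredinj hℓpk hpk0 b' hb'
    rw [← hredF Fr 2 hFrz]
    congr 1
    have hQ'mem : Q' ∈ geomTorsion (W.baseChange K) n := (mem_geomTorsion_iff _ _ _).mpr hQ'0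
    exact congrArg Subtype.val ((mem_torsionFixing_iff _ _).mp (hDfix hFrD) ⟨Q', hQ'mem⟩)
  -- `φ₀²` fixes `red Q`
  have hφQ : (φ₀ ^ 2) • red Q = red Q := by
    have h1 : ((p ^ k : ℕ) : ℤ) • (red Q - b) = 0 := by
      rw [smul_sub, ← map_zsmul, ← hn, hQ, hPdef, hb, hn, natCast_zsmul, sub_self]
    have h2 := hφtors _ h1
    rw [smul_sub, hφb] at h2
    exact sub_left_injective h2
  have hφQ' : ∀ j : ℕ, (φ₀ ^ (2 * j)) • red Q = red Q := by
    intro j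
    induction j with
    | zero => rw [mul_zero, pow_zero, one_smul]
    | succ j ih => rw [Nat.mul_succ, pow_add, mul_smul, hφQ, ih]
  -- the key vanishing: for `g ∈ D_{𝔓₀}` fixing `P` with `red (g • Q) = red Q`, `φ g = 0`
  have hcont := continuous_smul_geomPoints (W.baseChange K)
  have hval : ∀ g : absoluteGaloisGroup K, g • P = P → red (g • Q) = red Q →
      (KolyvaginCocycle.cocycle hA hcont hPinv hQ).1 g = 0 := by
    intro g hgP hgQ
    apply Subtype.ext
    rw [KolyvaginCocycle.coe_cocycle_apply, hgP, sub_self,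
      KolyvaginCocycle.rootIn_zero hA.eq_zero_of_zsmul, sub_zero]
    change g • Q - Q = ((0 : geomTorsion (W.baseChange K) n) : geomPoints (W.baseChange K))
    rw [ZeroMemClass.coe_zero]
    refine hredinj (p ^ k) hℓpk _ ?_ (by rw [map_sub, hgQ, sub_self])
    rw [smul_sub, ← hn, ← KolyvaginCocycle.smul_zsmul_comm, hQ, hgP, sub_self]
  -- transverse kernel: every place `w' ∋ ℓ` of `K[ℓ]`
  refine (mem_transverseKer_iff W K ι n ℓ _).mpr fun w' hw' ↦ ?_
  -- `w'` lies over `λ`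
  have hunder : ((ℓ : ℕ) : 𝓞 K) ∈ w'.asIdeal.under (𝓞 K) := by
    rw [Ideal.under, Ideal.mem_comap, map_natCast]; exact hw'
  have hne' : w'.asIdeal.under (𝓞 K) ≠ ⊥ := by
    intro hbot; rw [hbot, Ideal.mem_bot] at hunder; exact hℓp.ne_zero (by exact_mod_cast hunder)
  have hv₀ : (⟨w'.asIdeal.under (𝓞 K), Ideal.IsPrime.under (𝓞 K) w'.asIdeal, hne'⟩ :
      HeightOneSpectrum (𝓞 K)) = v := huniq _ hunder
  haveI hLO : w'.asIdeal.LiesOver v.asIdeal := ⟨by rw [← hv₀]⟩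
  haveI := (finiteDimensional_and_isGalois_ringClassField hK ι hℓp.ne_zero).2
  letI := (adicCompletionOfLiesOver K (ringClassField K ι ℓ) v w').toAlgebra
  refine (localization_mem_transverseSubgroup_iff ρK (ringClassField K ι ℓ) v w' _).mp ?_
  change galoisCohomology.localization ρK (Sum.inr v) 1
      (oneCocycleClass _ (KolyvaginCocycle.cocycle hA hcont hPinv hQ)) ∈ _
  refine localization_mem_transverseSubgroup_of_forall_apply_eq_zero (W.baseChange K) n
    (ringClassField K ι ℓ) v w' _ ?_
  -- the local cocycle on `Γ_{(w'.adicCompletion (ringClassField K ι ℓ))}`: a homomorphism, unramified, killed by a Frobenius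
  let θ' : absoluteGaloisGroup (w'.adicCompletion (ringClassField K ι ℓ)) →ₜ* absoluteGaloisGroup (v.adicCompletion K) := absGaloisRestrict (v.adicCompletion K) (w'.adicCompletion (ringClassField K ι ℓ))
  let ρL : DiscreteGaloisModule (w'.adicCompletion (ringClassField K ι ℓ)) (geomTorsion (W.baseChange K) n) :=
    (GaloisRep.toLocal v ρK).restrictField (w'.adicCompletion (ringClassField K ι ℓ))
  let ψL : contOneCocycles ρL.toTopRep :=
    contOneCocycles.pullback θ' (TopRep.ofHom ⟨ContinuousLinearMap.id ℤ _, fun _ => rfl⟩)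
      (contOneCocycles.pullback (absGaloisRestrict K (v.adicCompletion K))
        (TopRep.ofHom ⟨ContinuousLinearMap.id ℤ _, fun _ => rfl⟩)
        (KolyvaginCocycle.cocycle hA hcont hPinv hQ))
  have hψL : ∀ g', ψL.1 g' =
      (KolyvaginCocycle.cocycle hA hcont hPinv hQ).1 (absGaloisRestrict K (v.adicCompletion K) (θ' g')) := fun g' ↦ by
    rw [contOneCocycles.pullback_apply, contOneCocycles.pullback_apply]; rfl
  -- elements of `range θ'` fix `K[ℓ]` (FILE A), hence `K[c]` (BRICK B1), hence `P`
  let ιE : ringClassField K ι ℓ →ₐ[K] AlgebraicClosure K := IsAlgClosed.lift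
  have hle : ringClassField K ι ℓ ≤ ringClassField K ι c := ringClassField_mono hK ι hℓc hc0
  obtain ⟨γ, hγ⟩ := RingClassConj.exists_algEquiv_forall_apply_eq hK ι hℓp.ne_zero
    (ιE : ringClassField K ι ℓ →+* AlgebraicClosure K)
    ((e : ringClassField K ι c →+* AlgebraicClosure K).comp
      (RingClassField.inclusion ι hle : ringClassField K ι ℓ →+* ringClassField K ι c))
  have hfixP : ∀ g' : absoluteGaloisGroup (w'.adicCompletion (ringClassField K ι ℓ)), absGaloisRestrict K (v.adicCompletion K) (θ' g') • P = P := by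
    intro g'
    have hfixℓ : ∀ y : ringClassField K ι ℓ,
        absGaloisRestrict K (v.adicCompletion K) (θ' g') • ιE y = ιE y :=
      (SemiLocal.mem_range_absGaloisRestrict_adicCompletion_iff v ιE w' (θ' g')).mp ⟨g', rfl⟩
    have hfixc : ∀ x : ringClassField K ι c, absGaloisRestrict K (v.adicCompletion K) (θ' g') • e x = e x := by
      refine smul_ringClassField_emb_eq_of_mem_decompositionSubgroup hK hD ι hc hℓp hℓc hinert hv
        h𝔓₀ e (hresD _) fun x hx ↦ ?_
      let x' : ringClassField K ι ℓ := ⟨(x : ℂ), hx⟩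
      have hxx' : x = RingClassField.inclusion ι hle x' :=
        Subtype.ext (by rw [RingClassField.coe_inclusion])
      have hex : e x = ιE (γ x') := by rw [hxx']; exact hγ x'
      rw [hex, hfixℓ]
    exact smul_toGeomPoints_eq_self_of_forall_smul_emb d (fun x ↦ by rw [← he]; exact hfixc x) _
  -- pv-1's lemma on the local field `(w'.adicCompletion (ringClassField K ι ℓ)) = K[ℓ]_{w'}`
  have htriv : ∀ (g' : absoluteGaloisGroup (w'.adicCompletion (ringClassField K ι ℓ))) (w : geomTorsion (W.baseChange K) n), ρL g' w = w := by
    intro g' w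
    change absGaloisRestrict K (v.adicCompletion K) (θ' g') • w = w
    exact (mem_torsionFixing_iff _ _).mp (hDfix (hresD _)) w
  obtain ⟨φL, hφL⟩ := exists_isFrobPow_holds (F := (w'.adicCompletion (ringClassField K ι ℓ))) 1
  have hI : ∀ τ ∈ absInertia (w'.adicCompletion (ringClassField K ι ℓ)), ψL.1 τ = 0 := by
    intro τ hτ
    rw [hψL]
    have hτF : θ' τ ∈ absInertia (v.adicCompletion K) :=
      absInertia_map_absGaloisRestrict_le_holds (v.adicCompletion K) (w'.adicCompletion (ringClassField K ι ℓ)) ⟨τ, hτ, rfl⟩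
    have hτI : absGaloisRestrict K (v.adicCompletion K) (θ' τ) ∈ 𝔓₀.inertia (absoluteGaloisGroup K) := by
      rw [h𝔓₀def, inertia_adicCompletionPrime_eq_map_absInertia K v]
      exact ⟨θ' τ, hτF, rfl⟩
    exact hval _ (hfixP τ) (hredI _ hτI Q)
  have hφ0 : ψL.1 φL = 0 := by
    rw [hψL]
    -- `θ' φL` is a Frobenius power of exponent `f` for `K_v`, `q_v = ℓ²`
    set f := w'.asIdeal.inertiaDeg (𝓞 K) with hfdef
    have hqv : residueFieldCard (v.adicCompletion K) = ℓ ^ 2 := by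
      rw [residueFieldCard_adicCompletion_eq, residueCard_eq_sq_of_asIdeal_eq_span hK hℓp hinertℓ hv]
    have hqL : residueFieldCard (w'.adicCompletion (ringClassField K ι ℓ)) = residueFieldCard (v.adicCompletion K) ^ f := by
      rw [residueFieldCard_adicCompletion_eq, residueFieldCard_adicCompletion_eq]
      exact residueCard_eq_residueCard_pow_inertiaDeg hLO.over.symm
    have hfrob : IsFrobPow (θ' φL) ((f : ℤ) * 1) := IsFrobPow.absGaloisRestrict_holds (F := (v.adicCompletion K)) hφL f hqL
    rw [mul_one] at hfrob
    have hfrob' := isFrobPow_natCast_iff.mp hfrob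
    rw [hqv, ← pow_mul] at hfrob'
    have hg : ∀ z : absIntegers (𝓞 K) K,
        absGaloisRestrict K (v.adicCompletion K) (θ' φL) • z - z ^ (ℓ ^ (2 * f)) ∈ 𝔓₀ := fun z ↦
      forall_smul_sub_pow_mem_adicCompletionPrime v hfrob' z
    refine hval _ (hfixP φL) ?_
    rw [hredF _ (2 * f) hg, hφQ' f]
  intro g'
  have := GlobalDuality.apply_eq_zero_of_unramified_of_apply_frob_eq_zero ρL htriv hφL ψL hI hφ0 g'
  rwa [hψL] at this

/-- **Kolyvagin's class is transverse at the primes of its conductor at `p = 2`, MARGIN ONE**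
(`k + 1 ≤ M(ℓ)` at the prime `ℓ`, so `2^{k+1} ∣ ℓ + 1` and `2^k ∣ ℓ(ℓ+1)/2`; `k ≤ M(q)` at the other primes of
`c`). UNCONDITIONAL. [cite: Howard2004HeegnerKolyvagin, Lemma 2.7.3] [cite: Jetchev2008, Prop. 4.6 (p. 820)] -/
theorem kolyvaginClass_mem_transverseKer_two (hK : IsImaginaryQuadratic K)
    (hD : NumberField.discr K < -4)
    (Dt : ModularParametrizationData W (W.conductorNorm ℤ)) (β : ℤ) (ι : K →+* ℂ)
    [∀ j : ℕ, NumberField (ringClassField K ι j)] (k : ℕ) {c : ℕ} (hc : Squarefree c)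
    (hcK : ∀ ℓ ∈ c.primeFactors, Zhang2014.IsKolyvaginPrime (W.conductorNorm ℤ) W K 2 ℓ ∧
      k ≤ Zhang2014.kolyvaginIndex W 2 ℓ)
    (d : KolyvaginHeegnerData Dt β ι c) {ℓ : ℕ} (hℓ : ℓ ∈ c.primeFactors)
    (hkℓ : k + 1 ≤ Zhang2014.kolyvaginIndex W 2 ℓ) :
    haveI : Fact (Nat.Prime 2) := ⟨Nat.prime_two⟩
    (d.kolyvaginClass Nat.prime_two k :
      galoisCohomology ((W.baseChange K).torsionGaloisModule ((2 ^ k : ℕ) : ℤ)) 1) ∈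
      transverseKer W K ι ((2 ^ k : ℕ) : ℤ) ℓ := by
  haveI : Fact (Nat.Prime 2) := ⟨Nat.prime_two⟩
  exact kolyvaginClass_mem_transverseKer_of_dvd W hK hD Dt β ι k hc hcK d hℓ
    (two_pow_dvd_choose_two (Zhang2014.le_kolyvaginIndex_iff.mp hkℓ).1)

/-- **P4 — the binder `hP4` of the S1 composition for the GLOBAL intrinsic transverse family at `2`**:
for a square-free product `c` of Kolyvagin primes at `2` of index `≥ M + 1` and the tree's concrete datum
`dat` on `c`, `loc_w c_M(c) ∈ 𝒯_w` at every place `w ∣ c`, where `𝒯` is the global intrinsic transverse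
family of level `2^M` (`Walk.exists_globalTransverseFamily`; reconciliation `Walk.globalTransverse_mem_iff`).
UNCONDITIONAL. [cite: Howard2004HeegnerKolyvagin, Lemma 2.7.3] [cite: Jetchev2008, §3.1.2 (p. 814), Prop. 4.6] -/
theorem localization_kolyvaginClass_mem_globalTransverse_two (hK : IsImaginaryQuadratic K)
    (hD : NumberField.discr K < -4)
    (Dt : ModularParametrizationData W (W.conductorNorm ℤ)) (β : ℤ) (ι : K →+* ℂ)
    [∀ j : ℕ, NumberField (ringClassField K ι j)] (M : ℕ)
    {𝒯 : SelmerStructure ((W.baseChange K).torsionGaloisModule ((2 ^ M : ℕ) : ℤ))}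
    (h𝒯 : ∀ v : HeightOneSpectrum (𝓞 K), 𝒯 (Sum.inr v) =
      ⨅ (ℓ : ℕ) (_ : ℓ.Prime ∧ (ℓ : 𝓞 K) ∈ v.asIdeal),
        ⨅ (w' : HeightOneSpectrum (𝓞 (ringClassField K ι ℓ)))
          (_ : w'.asIdeal.LiesOver v.asIdeal),
          letI := (adicCompletionOfLiesOver K (ringClassField K ι ℓ) v w').toAlgebra
          transverseSubgroup (GaloisRep.toLocal v ((W.baseChange K).torsionGaloisModule ((2 ^ M : ℕ) : ℤ)))
            (w'.adicCompletion (ringClassField K ι ℓ)))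
    {c : ℕ} (dat : KolyvaginHeegnerData Dt β ι c)
    (hc : KolyvaginDescent.KolSupp (Zhang2014.IsKolyvaginPrime (W.conductorNorm ℤ) W K 2) c)
    (hcM : ∀ q ∈ c.primeFactors, M + 1 ≤ Zhang2014.kolyvaginIndex W 2 q) :
    ∀ w ∈ placesDividing K c,
      galoisCohomology.localization ((W.baseChange K).torsionGaloisModule ((2 ^ M : ℕ) : ℤ)) (Sum.inr w) 1
        (dat.kolyvaginClass Nat.prime_two M) ∈ 𝒯 (Sum.inr w) := by
  haveI : Fact (Nat.Prime 2) := ⟨Nat.prime_two⟩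
  refine (Walk.globalTransverse_mem_iff h𝒯 hc.1 _).mpr fun ℓ hℓ ↦ ?_
  exact kolyvaginClass_mem_transverseKer_two W hK hD Dt β ι M hc.1
    (fun q hq ↦ ⟨hc.2 q hq, Nat.le_of_succ_le (hcM q hq)⟩) dat hℓ (hcM ℓ hℓ)

end Main

end Summit.BirchSwinnertonDyer.Rank1Residual.JET

end
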